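import Literature.AlgebraicGeometry.HodgeTheory.GenericAbelianThreefoldPowersHodgeClasses
import Literature.AlgebraicGeometry.HodgeTheory.SimpleAbelianThreefoldQuadraticEndPowersHodgeClasses
import Literature.AlgebraicGeometry.HodgeTheory.SimpleAbelianSurfacePowersHodgeClasses
import Literature.RingTheory.CentralSimple.PositiveInvolutionSubfield
import HarnessLib

/-!
# Hodge classes on powers of a simple abelian threefold with a CUBIC endomorphism algebra, and the case split
# for simple threefolds (Moonen–Zarhin 1999 §2 (2.3): types I(1), I(3), IV(1,1), IV(3,·))

Family `hodge`, layer `Literature/AlgebraicGeometry/HodgeTheory`. Research context: cell `pub-hodge-ring2` (HONEST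
FRAMING: research route conditional on HC_CM; not a corollary; Q11.4-sentence-2 already refuted in dim ≥ 3),
Literature lane, programme R13 «generic abelian threefolds», sequel. UNCONDITIONAL for the classes of abelian
varieties it names; theorems only, no definition, no named fact (D-0026), no `sorry`.

WHAT IS PROVED.
* §1 `ThreefoldEnd.mul_comm_of_finrank_eq_three` — a `ℚ`-algebra of dimension `3` in which every non-zero element
  is a unit is COMMUTATIVE (for `x ∉ ℚ`, the field `ℚ[x]` has degree dividing `3` — the tree's
  `finrank_dvd_finrank_of_algHom` — hence equals the algebra); `AbelianVariety.isField_endAlgebra_of_isSimple_of_finrank_eq_three`.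
* §2 `AbelianVariety.isTotallyReal_endField_of_finrank_odd` — an endomorphism FIELD of odd degree of a complex
  abelian variety is totally real (it is totally real or CM by Rosati positivity, the tree's
  `isTotallyReal_or_isCMField_endField_of_riemann`; a CM field has even degree).
* §3 `AbelianVariety.isDivisorGenerated_powSucc_of_isSimple_threefold_of_finrank_eq_three` — MZ99 (2.3) Type I(3):
  a simple abelian threefold whose `End⁰` has `ℚ`-dimension `3` has `B = D` on all powers (by §1–§2 and the tree's
  real-multiplication theorem `isDivisorGenerated_powSucc_of_isTotallyReal`, Ribet 1983); the Hodge conjecture for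
  all its powers and their isogeny classes.
* §4 `AbelianVariety.finrank_endAlgebra_mem_of_isSimple_threefold` (`dim_ℚ End⁰ ∈ {1,2,3,6}`, from the tree's
  `finrank_endAlgebra_dvd_two_mul_dim`) and the case split
  `AbelianVariety.isDivisorGenerated_powSucc_of_isSimple_threefold`: for a SIMPLE complex abelian threefold `A`,
  `B = D` on all powers `A^{N+1}` PROVIDED `End⁰(A)` is commutative when it has dimension `6` — the four cases are
  `dim 1` (R13, `isDivisorGenerated_powSucc_of_threefold_endRankOne`), `dim 2`
  (`isDivisorGenerated_powSucc_of_isSimple_threefold_of_finrank_eq_two`), `dim 3` (§3), `dim 6` commutative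
  (`EndFieldFullDegree.isStablyNondegenerate_of_dim_le_five_of_ne_four`). The proviso is automatic — a division
  algebra has square dimension over its centre, so `ℚ`-dimension `6` forces commutativity — but that theorem of
  Wedderburn is not in the tree, so it is kept as a hypothesis.
  -- TODO(general form): remove `hcomm6` via «[D:ℚ] = [F:ℚ]·d²» (Swinnerton-Dyer §8, p. 63).

## References

* [MoonenZarhin1999LowDim] B. Moonen, Yu. Zarhin, Math. Ann. 315 (1999), §2 (2.3) [corpus: paper:arxiv-math_9901113
  p0005 L84–L105: «Type 1(1): X is an abelian 3-fold with End⁰(X) = ℚ … Type 1(3): End⁰(X) = F is a totally real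
  cubic field … Hg(X) = Res_{F/ℚ} Sp_F(V,ψ) … Type 4(1,1): End⁰(X) = F is an imaginary quadratic field … Hg(X) =
  U_F(V,ψ) … Type 4(3,1): End⁰(X) = F is a CM-field of degree 6»], p. 715.
* [Ribet1983] K. Ribet, Hodge classes on certain types of abelian varieties, Amer. J. Math. 105 (1983), Thm. 0–1.
* [Lange2023AbelianVarietiesComplex] H. Lange, Abelian Varieties over the Complex Numbers (2023), §2.6.1–2.6.2
  (`dim_ℚ F = e d²` divides `2g`; Lemma 2.6.4, 2.6.6: positive involutions on subfields).
* [MumfordAV1970] D. Mumford, Abelian Varieties (1970), §19 Cor. 2, §21 Thm. 2.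
* [SwinnertonDyer1974] H. P. F. Swinnerton-Dyer, Analytic Theory of Abelian Varieties (1974), §8 p. 63, Lemma 42.
-/

noncomputable section

open CategoryTheory Module NumberField

namespace Literature.AlgebraicGeometry.HodgeTheory

open Literature.AlgebraicGeometry.Motives Literature.AlgebraicGeometry.ComplexMultiplication
open Literature.AlgebraicGeometry.Motives.HodgeStructure
open Literature.RingTheory.CentralSimple (finrank_dvd_finrank_of_algHom)

/-! ### §1 A three-dimensional division algebra over `ℚ` is commutative -/

section Algebra

variable {D : Type*} [Ring D] [Algebra ℚ D]

open scoped IsMulCommutative in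
/-- A `ℚ`-algebra of dimension `3` in which every non-zero element is a unit is commutative: for `x ∉ ℚ·1` the
commutative subalgebra `ℚ[x]` is a field whose degree divides `3` (`finrank_dvd_finrank_of_algHom`), so
`ℚ[x] = D`. [cite: Lange2023AbelianVarietiesComplex, §2.6.1 (dim_ℚ F = e d² ∣ 2g; PDF p0139)] -/
theorem ThreefoldEnd.mul_comm_of_finrank_eq_three [Nontrivial D] (hD : ∀ x : D, x ≠ 0 → IsUnit x)
    (h3 : Module.finrank ℚ D = 3) (x y : D) : x * y = y * x := by
  classical
  haveI : Module.Finite ℚ D := Module.finite_of_finrank_eq_succ h3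
  haveI : NoZeroDivisors D := ⟨fun {a b} hab => by
    by_cases ha : a = 0
    · exact Or.inl ha
    · exact Or.inr (((hD a ha).mul_right_eq_zero).1 hab)⟩
  haveI : IsDomain D := NoZeroDivisors.to_isDomain D
  by_cases hx : x ∈ (⊥ : Subalgebra ℚ D)
  · rw [Algebra.mem_bot] at hx
    obtain ⟨q, rfl⟩ := hx
    exact Algebra.commutes q y
  -- the commutative subalgebra `K = ℚ[x]`, a field
  set K : Subalgebra ℚ D := Algebra.adjoin ℚ {x} with hK
  letI : CommRing ↥K := inferInstance
  haveI : Algebra.IsIntegral ℚ ↥K := Algebra.IsIntegral.of_finite ℚ ↥K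
  have hKf : IsField ↥K := isField_of_isIntegral_of_isField' (R := ℚ) (S := ↥K) (Field.toIsField ℚ)
  letI : Field ↥K := hKf.toField
  have hdvd : Module.finrank ℚ ↥K ∣ 3 := h3 ▸ finrank_dvd_finrank_of_algHom (K := ↥K) (D := D) K.val
  have hxK : x ∈ K := Algebra.self_mem_adjoin_singleton ℚ x
  rcases (Nat.dvd_prime Nat.prime_three).1 hdvd with h1 | h3'
  · exfalso
    apply hx
    have hbot : K = ⊥ := Subalgebra.eq_bot_of_finrank_one h1
    rw [← hbot]
    exact hxK
  · have htop : Subalgebra.toSubmodule K = ⊤ :=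
      Submodule.eq_top_of_finrank_eq (by rw [Subalgebra.finrank_toSubmodule, h3', h3])
    have hyK : y ∈ K := by
      rw [← Subalgebra.mem_toSubmodule, htop]
      exact Submodule.mem_top
    have h := mul_comm (⟨x, hxK⟩ : ↥K) ⟨y, hyK⟩
    exact congrArg Subtype.val h

end Algebra

/-! ### §2 Odd-degree endomorphism fields are totally real; the cubic case -/

section Threefold

variable {A : AbelianVariety ℂ}

/-- `End⁰(A)` of a SIMPLE abelian variety with `dim_ℚ End⁰(A) = 3` is a (cubic) field (§1 with Mumford §19 Cor. 2:
non-zero endomorphisms of a simple abelian variety are invertible). [cite: MumfordAV1970, §19 Cor. 2 of Thm. 1 (p. 174)]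
[cite: MoonenZarhin1999LowDim, §2 (2.3) Type I(3)] -/
theorem AbelianVariety.isField_endAlgebra_of_isSimple_of_finrank_eq_three (hA : A.IsSimple) (h0 : 0 < A.dim)
    (h3 : Module.finrank ℚ A.endAlgebra = 3) : IsField A.endAlgebra := by
  haveI : Nontrivial A.endAlgebra := nontrivial_endAlgebra_of_dim_pos h0
  exact AbelianVariety.isField_endAlgebra_of_isSimple_of_comm hA h0
    (ThreefoldEnd.mul_comm_of_finrank_eq_three (fun x hx => (isUnit_or_eq_zero_of_isSimple hA x).resolve_right hx) h3)

/-- **An endomorphism field of ODD degree is totally real**: by Rosati positivity `End⁰(A)` (a field) is totally real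
or CM (the tree's `isTotallyReal_or_isCMField_endField_of_riemann`), and a CM field is totally complex, of even
degree `2·#(complex places)`. [cite: Lange2023AbelianVarietiesComplex, §2.6.2 Lemma 2.6.4 and 2.6.6]
[cite: MumfordAV1970, §21 Thm. 2] -/
theorem AbelianVariety.isTotallyReal_endField_of_finrank_odd (h0 : 0 < A.dim) (hF : IsField A.endAlgebra)
    (hodd : Odd (Module.finrank ℚ A.endAlgebra)) : IsTotallyReal (EndField A hF) := by
  classical
  haveI : Nontrivial A.endAlgebra := nontrivial_endAlgebra_of_dim_pos h0
  rcases isTotallyReal_or_isCMField_endField_of_riemann hF deligneMilne1982_Thm_6_20_full_holds h0 with hR | hCM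
  · exact hR
  · exfalso
    haveI := hCM
    have h := NumberField.IsTotallyComplex.finrank (K := EndField A hF)
    rw [EndField.finrank_eq hF] at h
    exact (Nat.not_even_iff_odd.2 hodd) ⟨_, by rw [h, two_mul]⟩

/-- **MZ99 (2.3) Type I(3), all powers — UNCONDITIONAL: `B•(A^{N+1}) = D•(A^{N+1}) ⊗ ℂ`** for a SIMPLE complex
abelian threefold whose endomorphism algebra has `ℚ`-dimension `3` (then `End⁰(A)` is a totally real cubic field,
§1–§2, and Ribet's real-multiplication theorem — the tree's `isDivisorGenerated_powSucc_of_isTotallyReal` — applies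
with `[F:ℚ] = dim A`). [cite: MoonenZarhin1999LowDim, §2 (2.3) Type I(3) and p. 715] [cite: Ribet1983, Thm. 0–1] -/
theorem AbelianVariety.isDivisorGenerated_powSucc_of_isSimple_threefold_of_finrank_eq_three (A : AbelianVariety ℂ)
    (hA : A.IsSimple) (hdim : A.dim = 3) (h3 : Module.finrank ℚ A.endAlgebra = 3) (N : ℕ) :
    IsDivisorGenerated (A.powSucc N) := by
  have h0 : 0 < A.dim := by omega
  have hF : IsField A.endAlgebra := AbelianVariety.isField_endAlgebra_of_isSimple_of_finrank_eq_three hA h0 h3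
  haveI : IsTotallyReal (EndField A hF) :=
    AbelianVariety.isTotallyReal_endField_of_finrank_odd h0 hF (by rw [h3]; decide)
  exact AbelianVariety.isDivisorGenerated_powSucc_of_isTotallyReal A hF (by rw [h3, hdim]) N

/-- The Hodge conjecture for all powers of a simple abelian threefold with cubic `End⁰`.
[cite: MoonenZarhin1999LowDim, §2 (2.3) and p. 715] -/
theorem hodgeConjectureFor_powSucc_of_isSimple_threefold_of_finrank_eq_three (A : AbelianVariety ℂ)
    (hA : A.IsSimple) (hdim : A.dim = 3) (h3 : Module.finrank ℚ A.endAlgebra = 3) (N : ℕ) :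
    HodgeConjectureFor (A.powSucc N).dim (A.powSucc N).X :=
  hodgeConjectureFor_of_isDivisorGenerated _
    (AbelianVariety.isDivisorGenerated_powSucc_of_isSimple_threefold_of_finrank_eq_three A hA hdim h3 N)

/-! ### §3 The case split for simple abelian threefolds -/

/-- `dim_ℚ End⁰(A) ∈ {1, 2, 3, 6}` for a simple complex abelian threefold (`dim_ℚ End⁰ ∣ 2 dim A`, Lange §2.6.1 /
the tree's `finrank_endAlgebra_dvd_two_mul_dim`). [cite: Lange2023AbelianVarietiesComplex, §2.6.1 (PDF p0139)]
[cite: MoonenZarhin1999LowDim, §2 (2.3)] -/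
theorem AbelianVariety.finrank_endAlgebra_mem_of_isSimple_threefold (hA : A.IsSimple) (hdim : A.dim = 3) :
    Module.finrank ℚ A.endAlgebra = 1 ∨ Module.finrank ℚ A.endAlgebra = 2 ∨ Module.finrank ℚ A.endAlgebra = 3 ∨
      Module.finrank ℚ A.endAlgebra = 6 := by
  have hdvd : Module.finrank ℚ A.endAlgebra ∣ 6 := by
    have h := finrank_endAlgebra_dvd_two_mul_dim hA
    rwa [hdim] at h
  have hmem : Module.finrank ℚ A.endAlgebra ∈ Nat.divisors 6 := Nat.mem_divisors.2 ⟨hdvd, by norm_num⟩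
  have h6 : Nat.divisors 6 = {1, 2, 3, 6} := by decide
  rw [h6] at hmem
  simp only [Finset.mem_insert, Finset.mem_singleton] at hmem
  exact hmem

/-- **`B = D` on all powers of a SIMPLE complex abelian threefold, modulo Wedderburn for dimension `6`.** If
`End⁰(A)` is commutative whenever it has `ℚ`-dimension `6` (automatic, but Wedderburn's `[D:ℚ] = [F:ℚ]d²` is not in
the tree), then `B•(A^{N+1}) = D•(A^{N+1}) ⊗ ℂ` for every `N`: the cases `dim_ℚ End⁰ = 1` (R13: `Hg = Sp₆`), `2`
(imaginary/real quadratic, the tree), `3` (§2), `6` (a sextic field of degree `2 dim A`, the tree's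
`EndFieldFullDegree.isStablyNondegenerate_of_dim_le_five_of_ne_four`). MZ99 (2.3) with p. 715: «For g ≤ 3 … we always
find Hg(X) = Sp_D(V,φ) … B(Xⁿ) = D(Xⁿ) for all n». [cite: MoonenZarhin1999LowDim, §2 (2.3) and p. 715]
-- TODO(general form): drop `hcomm6` (a division algebra of `ℚ`-dimension 6 is a field: Swinnerton-Dyer §8 p. 63). -/
theorem AbelianVariety.isDivisorGenerated_powSucc_of_isSimple_threefold (A : AbelianVariety ℂ) (hA : A.IsSimple)
    (hdim : A.dim = 3) (hcomm6 : Module.finrank ℚ A.endAlgebra = 6 → ∀ x y : A.endAlgebra, x * y = y * x) (N : ℕ) :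
    IsDivisorGenerated (A.powSucc N) := by
  classical
  have h0 : 0 < A.dim := by omega
  haveI : Nontrivial A.endAlgebra := nontrivial_endAlgebra_of_dim_pos h0
  rcases AbelianVariety.finrank_endAlgebra_mem_of_isSimple_threefold hA hdim with h1 | h2 | h3 | h6
  · exact AbelianVariety.isDivisorGenerated_powSucc_of_threefold_endRankOne A h1 hdim N
  · exact AbelianVariety.isDivisorGenerated_powSucc_of_isSimple_threefold_of_finrank_eq_two A hA hdim h2 N
  · exact AbelianVariety.isDivisorGenerated_powSucc_of_isSimple_threefold_of_finrank_eq_three A hA hdim h3 N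
  · have hF : IsField A.endAlgebra := AbelianVariety.isField_endAlgebra_of_isSimple_of_comm hA h0 (hcomm6 h6)
    exact EndFieldFullDegree.isStablyNondegenerate_of_dim_le_five_of_ne_four (F := EndField A hF)
      (EndField.toEndAlgebra hF).toRingHom (by rw [EndField.finrank_eq, h6, hdim]) (by omega) (by omega) N

/-- The Hodge conjecture for all powers of a simple complex abelian threefold, modulo Wedderburn for dimension `6`
(as above). [cite: MoonenZarhin1999LowDim, §2 (2.3) and p. 715] -/
theorem hodgeConjectureFor_powSucc_of_isSimple_threefold (A : AbelianVariety ℂ) (hA : A.IsSimple) (hdim : A.dim = 3)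
    (hcomm6 : Module.finrank ℚ A.endAlgebra = 6 → ∀ x y : A.endAlgebra, x * y = y * x) (N : ℕ) :
    HodgeConjectureFor (A.powSucc N).dim (A.powSucc N).X :=
  hodgeConjectureFor_of_isDivisorGenerated _
    (AbelianVariety.isDivisorGenerated_powSucc_of_isSimple_threefold A hA hdim hcomm6 N)

end Threefold

end Literature.AlgebraicGeometry.HodgeTheory

end
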